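import Summits.BirchSwinnertonDyer.BirchSwinnertonDyer.Theorems.EisensteinPrimesX2TowerBudgetTorsionDischarged
import Summits.BirchSwinnertonDyer.BirchSwinnertonDyer.Theorems.EisensteinPrimesAnalyticLambdaAbsoluteCount
import Summits.BirchSwinnertonDyer.Rank1Residual.X2.TorsionForcesSplit
import Literature.NumberTheory.EllipticCurves.AnomalousOfRationalTorsionProofs
import HarnessLib

/-!
# Crux `MazurMCOnCellB` (stmt-BirchSwinnertonDyer-19033), line `mudescent`: ROUTE T AT THE ÉTALE END
# FROM THE TOWER BUDGET — Mazur's main conjecture at a split Eisenstein pair carrying rational `p`-torsion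
# from `μ_an = 0`, `λ_an = N` (odd), and census Tamagawa rows with `N ≤ Σ_v min(s_v, pⁿ)`
# (stub `stub_lambdaCount_offLocus`, both halves COMPOSED; LEAD seat bsd-line-x2-p1, D-0154 row 5)

HONEST FRAMING (cell `bsd-eis`; nothing here proves BSD or a main conjecture for any class; 0 cells
move): THEOREMS ONLY — no definition, no named fact, nothing asserted about any particular curve,
closes nothing. The analytic inputs (`X2.AnalyticMuLE W p 0`, `X2.AnalyticLambdaEq W p N`) are the
cell's per-pair certificates or — on the Mazur twin family — lam-a's THEOREM B′ ON PAPER (its value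
congruence `hval` below is a HYPOTHESIS); the named PUBLISHED facts are hypotheses BY NAME.

WHY. lam-a g9's route-T closure at the étale end
(`X2.mazurMainConjectureAt_etaleEnd_of_valueCongr_unit_of_dvd_localTamagawaNumber`, p547788) uses the
LAYER-`0` budget `λ_alg ≥ #S′ − 1` (lam-b, with the `a`-term of the split prime) and therefore needs
`Σ_{ℓ∈S} s_ℓ ≤ #S′` — «all `s_ℓ = 1`» (MEMO-9: fails at 1155n1, `s_7 = 5` at `p = 5`). With the TOWER
budget of `Theorems/EisensteinPrimesX2TowerBudgetTorsion{,Discharged}` (p608923 / its sequel: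
`λ_alg ≥ Σ_{v∈S′} p^{min(n,m_v)} − 2` at a `μ_an = 0` member with `v_p(#E(ℚ)_tors) = 1`, every layer
`n`, NO `a`-term) and the PARITY form of route T (`X2.mazurMainConjectureAt_of_algebraicLambdaGE_of_parity`:
`λ_an ≤ λ_alg + e + 1` when `λ_an ≡ r_an + e (mod 2)`, Greenberg Prop. 3.10 + GZK BY NAME), the side
condition becomes `N ≤ Σ_{v∈S′} min(s_v, pⁿ)` — i.e. NONE once `n ≥ max m_v` and `S′` are the places
under the raising set — at the price of the parity datum `N` odd (on the twin family `N = Σ_{ℓ∈S} s_ℓ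
≡ #S (mod 2)`, odd by the sign of the functional equation at analytic rank `0`; here a hypothesis).

* §1 `X2.mazurMainConjectureAt_of_analyticLambdaEq_of_towerBudget` — the composition in the stub
  currencies: `μ_an = 0`, `λ_an = N` odd, `N ≤ Σ_{v∈S′} p^{min(n,m_v)}`, `p ∣ #E(ℚ)_tors` with
  `v_p = 1`, `r_an = 0`, census rows ⇒ `X2.MazurMainConjectureAt W p`.
* §2 `X2.mazurMainConjectureAt_etaleEnd_of_valueCongr_unit_tower` — the same fed by THEOREM B's value
  congruence (lam-a's socket `X2.analyticMuLE_zero_and_analyticLambdaEq_sum_sFactor_of_valueCongr`,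
  p546280), `N = Σ_{ℓ∈S} s_ℓ`, parity datum `#S` odd: p547788 with «`Σ s_ℓ ≤ #S′`» replaced by
  «`Σ_{ℓ∈S} s_ℓ ≤ Σ_{v∈S′} p^{min(n,m_v)}`».

References: [GreenbergLNM1716] Prop. 3.10, Prop. 4.15 (ii), §5 pp. 114–118, p. 137; [Wuthrich2014]
Thm. 16; [GreenbergVatsal2000] §1 (9)–(10), §2 p. 28; [PollackWake2025] Thm. 5.12 (1); [Mazur1977] III
Cor. (8.5); HOME/lam-a-g9/lam-a-MEMO-9.md §5, HOME/lam-a-g10/lam-a-MEMO-10.md §2.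
-/

set_option autoImplicit false
-- `Summit.BirchSwinnertonDyer.BirchSwinnertonDyer.…`: the summit and its single sub-problem share a name (D-0017 layout).
set_option linter.dupNamespace false

noncomputable section

open scoped Classical MatrixGroups ModularForm

open PowerSeries CongruenceSubgroup WeierstrassCurve NumberField IsDedekindDomain
  Literature.NumberTheory.EllipticCurves
  Literature.NumberTheory.EllipticCurves.ModularForms
  Literature.NumberTheory.EllipticCurves.Rank1Residual
  Literature.NumberTheory.EllipticCurves.GreenbergVatsal2000
  Literature.NumberTheory.EllipticCurves.Wuthrich2014
  Literature.NumberTheory.EllipticCurves.Greenberg1999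
  Literature.NumberTheory.GaloisCohomology Literature.NumberTheory.GaloisRepresentations
  Summit.BirchSwinnertonDyer.Rank1Residual
  Summit.BirchSwinnertonDyer.Rank1Residual.X1.MuLambda
  Summit.BirchSwinnertonDyer.Rank1Residual.X1.TamagawaSqueeze
  Summit.BirchSwinnertonDyer.BirchSwinnertonDyer.Theorems.EisensteinPrimesAnalyticLambdaAbsoluteCount
  Summit.BirchSwinnertonDyer.BirchSwinnertonDyer.Theorems.EisensteinPrimesX2TowerBudgetTorsionDischarged

namespace Summit.BirchSwinnertonDyer.BirchSwinnertonDyer.Theorems.EisensteinPrimesMazurMCOnCellBTowerRouteT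

variable {W : WeierstrassCurve ℚ} [W.IsElliptic] [W.IsGloballyMinimal] {p : ℕ} [hp : Fact p.Prime]

/-! ## §1. Route T at a split pair with rational `p`-torsion from the tower budget, stub currencies -/

/-- **Mazur's main conjecture at a split Eisenstein pair carrying rational `p`-torsion, from
`μ_an = 0`, `λ_an = N` odd, and census Tamagawa rows with `N ≤ Σ_v min(s_v, pⁿ)`.** `W/ℚ` globally
minimal of analytic rank `0`, `p` odd of multiplicative reduction with `p ∣ #E(ℚ)_tors`,
`v_p(#E(ℚ)_tors) = 1` (so `p` is split and `E[p]` reducible — the étale end of a type-A split class);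
`X2.AnalyticMuLE W p 0` and `X2.AnalyticLambdaEq W p N` with `N` ODD (`λ_an ≡ r_an + e (mod 2)`,
`e = 1`); a layer `n` and a finite set `S` of places `v ∤ p` with `v_p(N(v)^{p−1} − 1) = m_v + 1`,
`p ∣ c_v(E)` and `N ≤ Σ_{v∈S} p^{min(n,m_v)}`. Named PUBLISHED facts: Wuthrich Thm. 16 (`hWu`),
modularity (`hpar`), Greenberg Prop. 4.15 (ii) (`h415`) and Prop. 3.10 (`h310`), GZK (`hGZK`),
Poitou–Tate / Euler–Poincaré over `ℚ_n` (`hPT`, `hEP`). Conclusion: `X2.MazurMainConjectureAt W p`.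
Proof: the tower budget gives `λ_alg ≥ Σ_v p^{min(n,m_v)} − 2 ≥ N − 2`; route T with parity needs
`λ_an ≤ λ_alg + 2` and `λ_an` odd at a split prime of a rank-`0` curve.
[cite: GreenbergLNM1716, Prop. 3.10, Prop. 4.15 (ii), §5 pp. 114–118, p. 137]
[cite: Wuthrich2014, Thm. 16 (p. 397)] [cite: GreenbergVatsal2000, §2 p. 28] -/
theorem X2.mazurMainConjectureAt_of_analyticLambdaEq_of_towerBudget (hodd : p ≠ 2)
    (hWu : thm16_charIdeal_dvd_multiplicative_of_reducible)
    (hpar : nonempty_modularParametrizationData)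
    (h415 : prop415ii_noFiniteSubmodule_of_ordinary_or_multiplicative)
    (h310 : prop310_selmerCorank_mod_two_eq_lambdaInvariant)
    (hGZK : rank_eq_analyticRank_of_analyticRank_le_one)
    (n : ℕ)
    (hPT : ∀ (κ : ZpExtension ℚ p) [NumberField (κ.layer n)], κ.IsCyclotomic →
      poitouTate_selmerStructure_duality (κ.layer n))
    (hEP : ∀ (κ : ZpExtension ℚ p) [NumberField (κ.layer n)], κ.IsCyclotomic →
      ∀ w : HeightOneSpectrum (𝓞 (κ.layer n)),
      localEulerPoincareCharacteristic (w.adicCompletion (κ.layer n)))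
    (hmult : W.HasMultiplicativeReductionAtPrime p) (htors : p ∣ W.torsionOrder)
    (hfac : (W.torsionOrder).factorization p = 1) (hr0 : W.analyticRank = 0)
    (S : Finset (HeightOneSpectrum (𝓞 ℚ))) (m : HeightOneSpectrum (𝓞 ℚ) → ℕ)
    (hSp : ∀ v ∈ S, ((p : ℕ) : 𝓞 ℚ) ∉ v.asIdeal)
    (hval : ∀ v ∈ S, padicValNat p (v.residueCard ^ (p - 1) - 1) = m v + 1)
    (hcv : ∀ v ∈ S,
      p ∣ (W.baseChange (v.adicCompletion ℚ)).localTamagawaNumber (v.adicCompletionIntegers ℚ))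
    {N : ℕ} (hμ0 : X2.AnalyticMuLE W p 0) (hlam : X2.AnalyticLambdaEq W p N) (hNodd : Odd N)
    (hN : N ≤ ∑ v ∈ S, p ^ min n (m v)) :
    X2.MazurMainConjectureAt W p := by
  have hp3 : 3 ≤ p := by
    have h2 := hp.out.two_le
    omega
  have hred : ¬ W.HasIrreducibleModPGaloisRep p :=
    not_hasIrreducibleModPGaloisRep_of_dvd_torsionOrder W p htors
  have hsplit : W.HasSplitMultiplicativeReductionAtPrime p :=
    X2.hasSplitMultiplicativeReductionAtPrime_of_dvd_torsionOrder W p hp3 hmult htors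
  -- the tower budget at the `μ_an = 0` member, torsion certificate discharged
  have halg := EisensteinPrimesX2TowerBudgetTorsionDischarged.X2.algebraicLambdaGE_layer_of_analyticMuLE
    hodd hWu hpar h415 hmult hred hμ0 n hPT hEP S m hSp hval hcv
  rw [hfac, mul_zero, Nat.sub_zero, mul_one] at halg
  -- route T with parity at the split prime
  refine X2.mazurMainConjectureAt_of_algebraicLambdaGE_of_parity hWu h310 hGZK W p hodd hmult hred
    (by rw [hr0]; exact zero_le_one) hμ0 hlam halg (fun hns ↦ absurd hsplit hns) (fun _ ↦ ⟨?_, ?_⟩)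
  · omega
  · rw [hr0, add_zero]; exact hNodd

/-! ## §2. The same fed by THEOREM B's value congruence (lam-a's socket p546280) -/

/-- `s_ℓ = p^{v_p(ℓ^{p−1} − 1) − 1}` is odd for odd `p`. [cite: GreenbergVatsal2000, §1 (9)] -/
theorem odd_sFactor (hodd : p ≠ 2) (ℓ : ℕ) : Odd (sFactor p ℓ) :=
  (hp.out.eq_two_or_odd'.resolve_left hodd).pow

/-- `Σ_{ℓ∈S} s_ℓ ≡ #S (mod 2)` for odd `p`. [cite: GreenbergVatsal2000, §1 (9)] -/
theorem sum_sFactor_mod_two (hodd : p ≠ 2) (S : Finset ℕ) :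
    (∑ ℓ ∈ S, sFactor p ℓ) % 2 = S.card % 2 := by
  induction S using Finset.induction_on with
  | empty => simp
  | insert a s ha ih =>
    rw [Finset.sum_insert ha, Finset.card_insert_of_notMem ha]
    have h1 : sFactor p a % 2 = 1 := Nat.odd_iff.mp (odd_sFactor hodd a)
    omega

/-- `Σ_{ℓ∈S} s_ℓ` is odd iff `#S` is odd (odd `p`). [cite: GreenbergVatsal2000, §1 (9)] -/
theorem odd_sum_sFactor_iff (hodd : p ≠ 2) (S : Finset ℕ) :
    Odd (∑ ℓ ∈ S, sFactor p ℓ) ↔ Odd S.card := by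
  rw [Nat.odd_iff, Nat.odd_iff, sum_sFactor_mod_two hodd S]

section ValueCongr

variable {N : ℕ} [NeZero N] {f : CuspForm (Gamma0 N) 2} {ϖ : ℚ} {L : PowerSeries ℚ_[p]}

/-- **Crux 3 at the ÉTALE END of a Mazur / Pollack–Wake twin-family pair, from THEOREM B's congruence,
the TOWER budget and the parity datum — p547788 without «all `s_ℓ = 1`».** `W` globally minimal of
analytic rank `0`, `p ≠ 2` multiplicative with `p ∣ #E(ℚ)_tors`, `v_p(#E(ℚ)_tors) = 1`; a layer `n`
and census rows `S′` (`v ∤ p`, `v_p(N(v)^{p−1} − 1) = m_v + 1`, `p ∣ c_v(E)`); ONE datum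
`(f, ϖ, L, G)` with THEOREM B's value congruence against `c·U·∏_{ℓ∈S}(1 − γ_ℓ)` (`U ∈ Λˣ`, `S` integers
`> 1` prime to `p` — the split primes `ℓ ∉ {p, q}`); the parity datum `#S` odd (sign of the functional
equation at analytic rank `0` on the family; HYPOTHESIS here) and the arithmetic side condition
`Σ_{ℓ∈S} s_ℓ ≤ Σ_{v∈S′} p^{min(n,m_v)}` (void for `S′` = the places under `S` and `n ≥ max m_v`).
Named PUBLISHED facts `hWu`, `hpar`, `h415`, `h310`, `hGZK`, `hPT`/`hEP` over `ℚ_n` BY NAME; the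
congruence `hval` is THEOREM B′ ON PAPER. Conclusion: `X2.MazurMainConjectureAt W p`.
[cite: Wuthrich2014, Thm. 16 (p. 397)] [cite: PollackWake2025, Thm. 5.12 (1)] [cite: Mazur1977, III Cor. (8.5)]
[cite: GreenbergLNM1716, Prop. 3.10, Prop. 4.15 (ii), §5 pp. 114–118, p. 137] -/
theorem X2.mazurMainConjectureAt_etaleEnd_of_valueCongr_unit_tower (hp2 : p ≠ 2)
    (hWu : thm16_charIdeal_dvd_multiplicative_of_reducible)
    (hpar : nonempty_modularParametrizationData)
    (h415 : prop415ii_noFiniteSubmodule_of_ordinary_or_multiplicative)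
    (h310 : prop310_selmerCorank_mod_two_eq_lambdaInvariant)
    (hGZK : rank_eq_analyticRank_of_analyticRank_le_one)
    (n : ℕ)
    (hPT : ∀ (κ : ZpExtension ℚ p) [NumberField (κ.layer n)], κ.IsCyclotomic →
      poitouTate_selmerStructure_duality (κ.layer n))
    (hEP : ∀ (κ : ZpExtension ℚ p) [NumberField (κ.layer n)], κ.IsCyclotomic →
      ∀ w : HeightOneSpectrum (𝓞 (κ.layer n)),
      localEulerPoincareCharacteristic (w.adicCompletion (κ.layer n)))
    (hmult : W.HasMultiplicativeReductionAtPrime p) (htors : p ∣ W.torsionOrder)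
    (hfac : (W.torsionOrder).factorization p = 1) (hr0 : W.analyticRank = 0)
    (S' : Finset (HeightOneSpectrum (𝓞 ℚ))) (m : HeightOneSpectrum (𝓞 ℚ) → ℕ)
    (hSp : ∀ v ∈ S', ((p : ℕ) : 𝓞 ℚ) ∉ v.asIdeal)
    (hvalS : ∀ v ∈ S', padicValNat p (v.residueCard ^ (p - 1) - 1) = m v + 1)
    (hcv : ∀ v ∈ S',
      p ∣ (W.baseChange (v.adicCompletion ℚ)).localTamagawaNumber (v.adicCompletionIntegers ℚ))
    (hf : IsNewformOf W f) (hϖ : (ϖ : ℝ) * W.realPeriodRat = plusPeriod f)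
    (hLs : W.HasSplitMultiplicativeReductionAtPrime p → IsSplitMultPAdicLFunctionOf f p L)
    (hLn : ¬ W.HasSplitMultiplicativeReductionAtPrime p → IsMultPAdicLFunctionOf f p (-1) L)
    {G : IwasawaAlgebra p} (hG : iwasawaToPowerSeries p G = PowerSeries.C ((ϖ : ℚ) : ℚ_[p]) * L)
    {U : IwasawaAlgebra p} (hU : IsUnit U) (S : Finset ℕ) (hS : ∀ ℓ ∈ S, p.Coprime ℓ ∧ 1 < ℓ)
    {c : ℤ_[p]} (hc : IsUnit c) {n₀ : ℕ}
    (hval : ∀ m : ℕ, n₀ ≤ m → ∀ ζ : ℂ_[p], IsPrimitiveRoot ζ (p ^ (m + 1)) →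
      ‖∑' k, ((algebraMap ℚ_[p] ℂ_[p]).comp (algebraMap ℤ_[p] ℚ_[p]))
          (PowerSeries.coeff k (G - PowerSeries.C c * (U * ∏ ℓ ∈ S, (1 - frobeniusSeries p ℓ)))) *
            (ζ - 1) ^ k‖ ≤ (p : ℝ)⁻¹)
    (hSodd : Odd S.card) (hsum : ∑ ℓ ∈ S, sFactor p ℓ ≤ ∑ v ∈ S', p ^ min n (m v)) :
    X2.MazurMainConjectureAt W p := by
  obtain ⟨hμ0, hlam⟩ := X2.analyticMuLE_zero_and_analyticLambdaEq_sum_sFactor_of_valueCongr hp2 hf hϖ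
    hLs hLn hG hU S hS hc hval
  exact X2.mazurMainConjectureAt_of_analyticLambdaEq_of_towerBudget hp2 hWu hpar h415 h310 hGZK n hPT hEP
    hmult htors hfac hr0 S' m hSp hvalS hcv hμ0 hlam ((odd_sum_sFactor_iff hp2 S).mpr hSodd) hsum

end ValueCongr

end Summit.BirchSwinnertonDyer.BirchSwinnertonDyer.Theorems.EisensteinPrimesMazurMCOnCellBTowerRouteT

end
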